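import Mathlib
import Summits.HubbardSuperconductivity.HubbardSuperconductivity.Theorems.WeakCouplingBCSKlLindhardSRepFold
import HarnessLib

/-!
# The square-lattice `s`-representation at its fold, III: two-sided fold expansions of the sheet functions

# Route `WeakCouplingBCS` — certificate half of stmt-HubbardSuperconductivity-0158 (t′ = 0 enclosure discharge, crux-idea «caustic-closed-form-row»).

Cell `gate-hubbard-kl`; filed by prover seat p4 g25 (pen (R511)(A)) under `Summits/…/Theorems/` — RE-HOMED from the planner's
Literature-shaped turnkey (`Literature/MathematicalPhysics/QuantumLattice/LindhardSRepFoldExpansion.lean`, hubbard-klscan-idea-4 g13 r13 ADDENDUM 5b,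
sha16 867ea046085238e5) next to part I (✓ `…WeakCouplingBCSKlLindhardSRepFold.lean`): these fold/log facts are the cell's own analysis of the
free integrand («new results belong under Summits/<Summit>/», `lint.literature-cited-only`); namespace `Summit.HubbardSuperconductivity.HubbardSuperconductivity.Theorems`
with `open Literature.MathematicalPhysics.QuantumLattice`; statements and proofs byte-identical to the turnkey (its private copy `sqrt_one_add_bounds_aux` kept although part I's `sqrt_one_add_bounds` is public here).
 With `cᵢ = |cos(qᵢ/2)|`, `Sᵢ = 1 − cᵢ²`, `σ = s − ½`,
`T = sRepFoldT c₀ c₁ S₀ S₁ σ = (4σ²(S₀c₁² + S₁c₀²) + 16S₀S₁σ⁴)/(c₀²c₁²) = O(σ²)`: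
`X(s) ∈ X₀ − κσ² − 64S₀S₁σ⁴/(c₀c₁) + [0, c₀c₁T²]`, `κ = 16(c₀−c₁)²(1 + 1/(c₀c₁))` (Kohn sheet;
`= 4μ²(1+1/(c₀c₁))` on the sheet) and `P(s) ∈ P₀ + κ′σ² + 64S₀S₁σ⁴/(c₀c₁) + [−c₀c₁T², 0]`,
`κ′ = 16(c₀+c₁)²(1/(c₀c₁) − 1) ≥ 0` (band edge), abstractly (`kohn_sheet_fold_two_sided`,
`edge_sheet_fold_two_sided`, via `fold_product_two_sided`: `c₀c₁(1 + T/2 − T²/8) ≤ A₀A₁ ≤ c₀c₁(1 + T/2)`)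
and at Momentum level under `RidgeClear η q`, `η > 0` (`kohnSheet_fold_two_sided`, `edgeSheet_fold_two_sided`).
The final certificates are LINEAR in the atoms `A₀², A₁², A₀A₁`.
Part (f): the quadratic PINCH `X₀ − (3κ/2)σ² ≤ X(s) ≤ X₀ − (κ/2)σ²` for `σ² ≤ (c₀−c₁)²(c₀c₁)²/18`
(`kohn_sheet_fold_pinch`, `kohnSheet_fold_pinch`) — a closed-form curvature certificate at the fold.

Provenance: cell gate-hubbard-kl, planner seat hubbard-klscan-idea-4 g13, §11 of the crux-idea sketch
«caustic-closed-form-row» on stmt-HubbardSuperconductivity-0158 (the certified `κ` of its model integrals).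

## References
* [RaghuKivelsonScalapino2010] S. Raghu, S. A. Kivelson, D. J. Scalapino, Phys. Rev. B 81 (2010) 224505, §II (5)–(6)
  (the square-lattice Lindhard / DOS objects).
* Cell note CERT-SREP §1–§2 (gate-hubbard-kl, 2026), identity (I1) and the bounds (B1)–(B2).
-/

noncomputable section

-- the tree's namespace `Summit.<Summit>.<Problem>.Theorems` repeats the summit name by design (D-0017)
set_option linter.dupNamespace false

open Real _root_.MeasureTheory _root_.Set
open Literature.Probability.RandomPlanarGeometry Literature.MathematicalPhysics.QuantumLattice

namespace Summit.HubbardSuperconductivity.HubbardSuperconductivity.Theorems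

/-! ### (e) The fold expansion of the Kohn sheet function: `X(s) = X₀ − κσ² + O(σ⁴)`, two-sided -/

/-- The relative fold parameter of the amplitude PRODUCT:
`A₀A₁ = c₀c₁ √(1 + T)`, `T = (4σ²(S₀c₁² + S₁c₀²) + 16 S₀S₁σ⁴)/(c₀²c₁²)`.
[cite: RaghuKivelsonScalapino2010, §II (5)–(6)] -/
def sRepFoldT (c₀ c₁ S₀ S₁ σ : ℝ) : ℝ :=
  (4 * σ ^ 2 * (S₀ * c₁ ^ 2 + S₁ * c₀ ^ 2) + 16 * S₀ * S₁ * σ ^ 4) / (c₀ ^ 2 * c₁ ^ 2)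

/-- `sRepFoldT ≥ 0` for `0 ≤ Sᵢ` and `cᵢ ≠ 0`-free (squares).
[cite: RaghuKivelsonScalapino2010, §II (5)–(6)] -/
theorem sRepFoldT_nonneg {c₀ c₁ S₀ S₁ : ℝ} (hS₀ : 0 ≤ S₀) (hS₁ : 0 ≤ S₁) (σ : ℝ) :
    0 ≤ sRepFoldT c₀ c₁ S₀ S₁ σ := by
  unfold sRepFoldT; positivity

/-- `1 + t/2 − t²/8 ≤ √(1+t) ≤ 1 + t/2` for `t ≥ 0`. [folklore] -/
private theorem sqrt_one_add_bounds_aux {t : ℝ} (ht0 : 0 ≤ t) :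
    1 + t / 2 - t ^ 2 / 8 ≤ Real.sqrt (1 + t) ∧ Real.sqrt (1 + t) ≤ 1 + t / 2 := by
  have hpos : 0 < 1 + t := by linarith
  set r := Real.sqrt (1 + t) with hr
  have hr2 : r ^ 2 = 1 + t := Real.sq_sqrt hpos.le
  have hr1 : 1 ≤ r := Real.one_le_sqrt.mpr (by linarith)
  have ht : t = r ^ 2 - 1 := by linarith
  rw [ht]
  constructor
  · have key : 1 + (r ^ 2 - 1) / 2 - (r ^ 2 - 1) ^ 2 / 8 - r = -((r - 1) ^ 3 * (r + 3) / 8) := by ring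
    have hnn : 0 ≤ (r - 1) ^ 3 * (r + 3) / 8 := by
      have : 0 ≤ (r - 1) ^ 3 := pow_nonneg (by linarith) 3
      positivity
    linarith
  · have key : 1 + (r ^ 2 - 1) / 2 - r = (r - 1) ^ 2 / 2 := by ring
    have hnn : 0 ≤ (r - 1) ^ 2 / 2 := by positivity
    linarith


/-- Two-sided bound for the amplitude product `√(c₀² + 4S₀σ²)·√(c₁² + 4S₁σ²)` around the fold.
[cite: RaghuKivelsonScalapino2010, §II (5)–(6)] -/
theorem fold_product_two_sided {c₀ c₁ S₀ S₁ : ℝ} (hc₀ : 0 < c₀) (hc₁ : 0 < c₁) (hS₀ : 0 ≤ S₀)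
    (hS₁ : 0 ≤ S₁) (σ : ℝ) :
    c₀ * c₁ * (1 + sRepFoldT c₀ c₁ S₀ S₁ σ / 2 - sRepFoldT c₀ c₁ S₀ S₁ σ ^ 2 / 8) ≤
        Real.sqrt (c₀ ^ 2 + 4 * S₀ * σ ^ 2) * Real.sqrt (c₁ ^ 2 + 4 * S₁ * σ ^ 2) ∧
      Real.sqrt (c₀ ^ 2 + 4 * S₀ * σ ^ 2) * Real.sqrt (c₁ ^ 2 + 4 * S₁ * σ ^ 2) ≤
        c₀ * c₁ * (1 + sRepFoldT c₀ c₁ S₀ S₁ σ / 2) := by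
  have h0 : c₀ ≠ 0 := hc₀.ne'
  have h1 : c₁ ≠ 0 := hc₁.ne'
  have ht0 := sRepFoldT_nonneg (c₀ := c₀) (c₁ := c₁) hS₀ hS₁ σ
  have hXY : (c₀ ^ 2 + 4 * S₀ * σ ^ 2) * (c₁ ^ 2 + 4 * S₁ * σ ^ 2) =
      (c₀ * c₁) ^ 2 * (1 + sRepFoldT c₀ c₁ S₀ S₁ σ) := by
    unfold sRepFoldT; field_simp; ring
  have hprod : Real.sqrt (c₀ ^ 2 + 4 * S₀ * σ ^ 2) * Real.sqrt (c₁ ^ 2 + 4 * S₁ * σ ^ 2) =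
      c₀ * c₁ * Real.sqrt (1 + sRepFoldT c₀ c₁ S₀ S₁ σ) := by
    rw [← Real.sqrt_mul' _ (by positivity), hXY, Real.sqrt_mul (by positivity),
      Real.sqrt_sq (by positivity)]
  rw [hprod]
  have hcc : 0 ≤ c₀ * c₁ := by positivity
  obtain ⟨h1, h2⟩ := sqrt_one_add_bounds_aux ht0
  exact ⟨mul_le_mul_of_nonneg_left h1 hcc, mul_le_mul_of_nonneg_left h2 hcc⟩

/-- **The Kohn sheet function around the fold, two-sided (abstract sheet coordinates).** For
`0 < cᵢ ≤ 1` (`cᵢ = |cos(qᵢ/2)|`, `Sᵢ = 1 − cᵢ²`) and all `σ = s − ½`: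
`X₀ − κσ² − 64S₀S₁σ⁴/(c₀c₁) ≤ X(s) ≤ X₀ − κσ² − 64S₀S₁σ⁴/(c₀c₁) + c₀c₁T²`,
`κ = 16(c₀−c₁)²(1 + 1/(c₀c₁))` (`= 4μ²(1 + 1/(c₀c₁))` ON the sheet `X₀ = 0`), `T = sRepFoldT … = O(σ²)`.
[cite: RaghuKivelsonScalapino2010, §II (5)–(6)] -/
theorem kohn_sheet_fold_two_sided {c₀ c₁ : ℝ} (hc₀ : 0 < c₀) (hc₁ : 0 < c₁) (hc₀1 : c₀ ≤ 1)
    (hc₁1 : c₁ ≤ 1) (μ σ : ℝ) :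
    4 * (c₁ - c₀) ^ 2 - μ ^ 2 - 16 * (c₀ - c₁) ^ 2 * (1 + 1 / (c₀ * c₁)) * σ ^ 2 -
          64 * (1 - c₀ ^ 2) * (1 - c₁ ^ 2) * σ ^ 4 / (c₀ * c₁) ≤
        4 * (Real.sqrt (c₁ ^ 2 + 4 * (1 - c₁ ^ 2) * σ ^ 2) -
            Real.sqrt (c₀ ^ 2 + 4 * (1 - c₀ ^ 2) * σ ^ 2)) ^ 2 - μ ^ 2 ∧
      4 * (Real.sqrt (c₁ ^ 2 + 4 * (1 - c₁ ^ 2) * σ ^ 2) -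
            Real.sqrt (c₀ ^ 2 + 4 * (1 - c₀ ^ 2) * σ ^ 2)) ^ 2 - μ ^ 2 ≤
        4 * (c₁ - c₀) ^ 2 - μ ^ 2 - 16 * (c₀ - c₁) ^ 2 * (1 + 1 / (c₀ * c₁)) * σ ^ 2 -
            64 * (1 - c₀ ^ 2) * (1 - c₁ ^ 2) * σ ^ 4 / (c₀ * c₁) +
          c₀ * c₁ * sRepFoldT c₀ c₁ (1 - c₀ ^ 2) (1 - c₁ ^ 2) σ ^ 2 := by
  have h0 : c₀ ≠ 0 := hc₀.ne'
  have h1 : c₁ ≠ 0 := hc₁.ne'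
  have hS₀ : 0 ≤ 1 - c₀ ^ 2 := by nlinarith
  have hS₁ : 0 ≤ 1 - c₁ ^ 2 := by nlinarith
  obtain ⟨hlo, hhi⟩ := fold_product_two_sided hc₀ hc₁ hS₀ hS₁ σ
  set A₀ := Real.sqrt (c₀ ^ 2 + 4 * (1 - c₀ ^ 2) * σ ^ 2) with hA₀
  set A₁ := Real.sqrt (c₁ ^ 2 + 4 * (1 - c₁ ^ 2) * σ ^ 2) with hA₁
  set t := sRepFoldT c₀ c₁ (1 - c₀ ^ 2) (1 - c₁ ^ 2) σ with ht
  have hsq₀ : A₀ ^ 2 = c₀ ^ 2 + 4 * (1 - c₀ ^ 2) * σ ^ 2 :=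
    Real.sq_sqrt (add_nonneg (sq_nonneg _) (mul_nonneg (mul_nonneg (by norm_num) hS₀) (sq_nonneg _)))
  have hsq₁ : A₁ ^ 2 = c₁ ^ 2 + 4 * (1 - c₁ ^ 2) * σ ^ 2 :=
    Real.sq_sqrt (add_nonneg (sq_nonneg _) (mul_nonneg (mul_nonneg (by norm_num) hS₁) (sq_nonneg _)))
  have hexp : (A₁ - A₀) ^ 2 = A₁ ^ 2 - 2 * (A₀ * A₁) + A₀ ^ 2 := by ring
  have key : 4 * (c₁ ^ 2 + 4 * (1 - c₁ ^ 2) * σ ^ 2) + 4 * (c₀ ^ 2 + 4 * (1 - c₀ ^ 2) * σ ^ 2) -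
        8 * (c₀ * c₁ * (1 + t / 2)) - μ ^ 2 =
      4 * (c₁ - c₀) ^ 2 - μ ^ 2 - 16 * (c₀ - c₁) ^ 2 * (1 + 1 / (c₀ * c₁)) * σ ^ 2 -
        64 * (1 - c₀ ^ 2) * (1 - c₁ ^ 2) * σ ^ 4 / (c₀ * c₁) := by
    rw [ht]; unfold sRepFoldT; field_simp; ring
  have key2 : c₀ * c₁ * (1 + t / 2 - t ^ 2 / 8) = c₀ * c₁ * (1 + t / 2) - c₀ * c₁ * t ^ 2 / 8 := by
    ring
  constructor
  · linarith [hexp, hsq₀, hsq₁, hhi, key]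
  · linarith [hexp, hsq₀, hsq₁, hlo, key, key2]

/-- The Kohn sheet function of the `s`-representation in fold coordinates.
[cite: RaghuKivelsonScalapino2010, §II (5)–(6)] -/
theorem kohnSheet_eq_fold (μ : ℝ) (q : Momentum) (s : ℝ) :
    kohnSheet μ q s =
      4 * (Real.sqrt (|Real.cos (q 1 / 2)| ^ 2 + 4 * (1 - |Real.cos (q 1 / 2)| ^ 2) * (s - 1 / 2) ^ 2) -
          Real.sqrt (|Real.cos (q 0 / 2)| ^ 2 + 4 * (1 - |Real.cos (q 0 / 2)| ^ 2) * (s - 1 / 2) ^ 2)) ^ 2 -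
        μ ^ 2 := by
  have h : ∀ t σ : ℝ, Real.sqrt ((1 - Real.sin t ^ 2) + 4 * Real.sin t ^ 2 * σ ^ 2) =
      Real.sqrt (|Real.cos t| ^ 2 + 4 * (1 - |Real.cos t| ^ 2) * σ ^ 2) := by
    intro t σ; congr 1; rw [sq_abs, Real.sin_sq]; ring
  simp only [kohnSheet, sRepAmp_eq_fold, h]

/-- **K3-geometry input, certified (Momentum level):** under `RidgeClear η q` (`η > 0`) the Kohn sheet
function of the tree's `s`-representation satisfies, for every `s`, the two-sided fold expansion of
`kohn_sheet_fold_two_sided` with `cᵢ = |cos(qᵢ/2)|`, `X₀ = kohnSheetFold μ q`.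
[cite: RaghuKivelsonScalapino2010, §II (5)–(6)] -/
theorem kohnSheet_fold_two_sided (μ : ℝ) (q : Momentum) {η : ℝ} (hη : 0 < η) (hR : RidgeClear η q) (s : ℝ) :
    kohnSheetFold μ q -
          16 * (|Real.cos (q 0 / 2)| - |Real.cos (q 1 / 2)|) ^ 2 *
            (1 + 1 / (|Real.cos (q 0 / 2)| * |Real.cos (q 1 / 2)|)) * (s - 1 / 2) ^ 2 -
          64 * (1 - |Real.cos (q 0 / 2)| ^ 2) * (1 - |Real.cos (q 1 / 2)| ^ 2) * (s - 1 / 2) ^ 4 /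
            (|Real.cos (q 0 / 2)| * |Real.cos (q 1 / 2)|) ≤ kohnSheet μ q s ∧
      kohnSheet μ q s ≤
        kohnSheetFold μ q -
          16 * (|Real.cos (q 0 / 2)| - |Real.cos (q 1 / 2)|) ^ 2 *
            (1 + 1 / (|Real.cos (q 0 / 2)| * |Real.cos (q 1 / 2)|)) * (s - 1 / 2) ^ 2 -
          64 * (1 - |Real.cos (q 0 / 2)| ^ 2) * (1 - |Real.cos (q 1 / 2)| ^ 2) * (s - 1 / 2) ^ 4 /
            (|Real.cos (q 0 / 2)| * |Real.cos (q 1 / 2)|) +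
          |Real.cos (q 0 / 2)| * |Real.cos (q 1 / 2)| *
            sRepFoldT (|Real.cos (q 0 / 2)|) (|Real.cos (q 1 / 2)|) (1 - |Real.cos (q 0 / 2)| ^ 2)
              (1 - |Real.cos (q 1 / 2)| ^ 2) (s - 1 / 2) ^ 2 := by
  rw [kohnSheet_eq_fold]
  unfold kohnSheetFold
  exact kohn_sheet_fold_two_sided (hη.trans_le (hR 0)) (hη.trans_le (hR 1)) (Real.abs_cos_le_one _)
    (Real.abs_cos_le_one _) μ (s - 1 / 2)

/-- **The band-edge sheet function around the fold, two-sided (abstract sheet coordinates).** For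
`0 < cᵢ ≤ 1`: `P₀ + κ′σ² + 64S₀S₁σ⁴/(c₀c₁) − c₀c₁T² ≤ P(s) ≤ P₀ + κ′σ² + 64S₀S₁σ⁴/(c₀c₁)`,
`κ′ = 16(c₀+c₁)²(1/(c₀c₁) − 1) ≥ 0` (`= 8|μ|((1−c₀²)/c₀ + (1−c₁²)/c₁)` ON the sheet `P₀ = 0`).
[cite: RaghuKivelsonScalapino2010, §II (5)–(6)] -/
theorem edge_sheet_fold_two_sided {c₀ c₁ : ℝ} (hc₀ : 0 < c₀) (hc₁ : 0 < c₁) (hc₀1 : c₀ ≤ 1)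
    (hc₁1 : c₁ ≤ 1) (μ σ : ℝ) :
    4 * (c₀ + c₁) ^ 2 - μ ^ 2 + 16 * (c₀ + c₁) ^ 2 * (1 / (c₀ * c₁) - 1) * σ ^ 2 +
          64 * (1 - c₀ ^ 2) * (1 - c₁ ^ 2) * σ ^ 4 / (c₀ * c₁) -
          c₀ * c₁ * sRepFoldT c₀ c₁ (1 - c₀ ^ 2) (1 - c₁ ^ 2) σ ^ 2 ≤
        4 * (Real.sqrt (c₀ ^ 2 + 4 * (1 - c₀ ^ 2) * σ ^ 2) +
            Real.sqrt (c₁ ^ 2 + 4 * (1 - c₁ ^ 2) * σ ^ 2)) ^ 2 - μ ^ 2 ∧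
      4 * (Real.sqrt (c₀ ^ 2 + 4 * (1 - c₀ ^ 2) * σ ^ 2) +
            Real.sqrt (c₁ ^ 2 + 4 * (1 - c₁ ^ 2) * σ ^ 2)) ^ 2 - μ ^ 2 ≤
        4 * (c₀ + c₁) ^ 2 - μ ^ 2 + 16 * (c₀ + c₁) ^ 2 * (1 / (c₀ * c₁) - 1) * σ ^ 2 +
          64 * (1 - c₀ ^ 2) * (1 - c₁ ^ 2) * σ ^ 4 / (c₀ * c₁) := by
  have h0 : c₀ ≠ 0 := hc₀.ne'
  have h1 : c₁ ≠ 0 := hc₁.ne'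
  have hS₀ : 0 ≤ 1 - c₀ ^ 2 := by nlinarith
  have hS₁ : 0 ≤ 1 - c₁ ^ 2 := by nlinarith
  obtain ⟨hlo, hhi⟩ := fold_product_two_sided hc₀ hc₁ hS₀ hS₁ σ
  set A₀ := Real.sqrt (c₀ ^ 2 + 4 * (1 - c₀ ^ 2) * σ ^ 2) with hA₀
  set A₁ := Real.sqrt (c₁ ^ 2 + 4 * (1 - c₁ ^ 2) * σ ^ 2) with hA₁
  set t := sRepFoldT c₀ c₁ (1 - c₀ ^ 2) (1 - c₁ ^ 2) σ with ht
  have hsq₀ : A₀ ^ 2 = c₀ ^ 2 + 4 * (1 - c₀ ^ 2) * σ ^ 2 :=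
    Real.sq_sqrt (add_nonneg (sq_nonneg _) (mul_nonneg (mul_nonneg (by norm_num) hS₀) (sq_nonneg _)))
  have hsq₁ : A₁ ^ 2 = c₁ ^ 2 + 4 * (1 - c₁ ^ 2) * σ ^ 2 :=
    Real.sq_sqrt (add_nonneg (sq_nonneg _) (mul_nonneg (mul_nonneg (by norm_num) hS₁) (sq_nonneg _)))
  have hexp : (A₀ + A₁) ^ 2 = A₀ ^ 2 + 2 * (A₀ * A₁) + A₁ ^ 2 := by ring
  have key : 4 * (c₀ ^ 2 + 4 * (1 - c₀ ^ 2) * σ ^ 2) + 4 * (c₁ ^ 2 + 4 * (1 - c₁ ^ 2) * σ ^ 2) +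
        8 * (c₀ * c₁ * (1 + t / 2)) - μ ^ 2 =
      4 * (c₀ + c₁) ^ 2 - μ ^ 2 + 16 * (c₀ + c₁) ^ 2 * (1 / (c₀ * c₁) - 1) * σ ^ 2 +
        64 * (1 - c₀ ^ 2) * (1 - c₁ ^ 2) * σ ^ 4 / (c₀ * c₁) := by
    rw [ht]; unfold sRepFoldT; field_simp; ring
  have key2 : c₀ * c₁ * (1 + t / 2 - t ^ 2 / 8) = c₀ * c₁ * (1 + t / 2) - c₀ * c₁ * t ^ 2 / 8 := by
    ring
  constructor
  · linarith [hexp, hsq₀, hsq₁, hlo, key, key2]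
  · linarith [hexp, hsq₀, hsq₁, hhi, key]

/-- `κ′ ≥ 0`: the band-edge sheet function is convex at the fold (cf. `edgeSheetFold_le_edgeSheet`).
[cite: RaghuKivelsonScalapino2010, §II (5)–(6)] -/
theorem edge_fold_kappa_nonneg {c₀ c₁ : ℝ} (hc₀ : 0 < c₀) (hc₁ : 0 < c₁) (hc₀1 : c₀ ≤ 1)
    (hc₁1 : c₁ ≤ 1) : 0 ≤ 16 * (c₀ + c₁) ^ 2 * (1 / (c₀ * c₁) - 1) := by
  have hcc : c₀ * c₁ ≤ 1 := by nlinarith [mul_pos hc₀ hc₁]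
  have : 0 ≤ 1 / (c₀ * c₁) - 1 := by
    rw [sub_nonneg, le_div_iff₀ (mul_pos hc₀ hc₁)]; linarith
  positivity

/-- Bridge: `edgeSheet` in fold coordinates `cᵢ = |cos(qᵢ/2)|`, `Sᵢ = 1 − cᵢ²`.
[cite: RaghuKivelsonScalapino2010, §II (5)–(6)] -/
theorem edgeSheet_eq_fold (μ : ℝ) (q : Momentum) (s : ℝ) :
    edgeSheet μ q s =
      4 * (Real.sqrt (|Real.cos (q 0 / 2)| ^ 2 + 4 * (1 - |Real.cos (q 0 / 2)| ^ 2) * (s - 1 / 2) ^ 2) +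
          Real.sqrt (|Real.cos (q 1 / 2)| ^ 2 + 4 * (1 - |Real.cos (q 1 / 2)| ^ 2) * (s - 1 / 2) ^ 2)) ^ 2 -
        μ ^ 2 := by
  have h : ∀ t σ : ℝ, Real.sqrt ((1 - Real.sin t ^ 2) + 4 * Real.sin t ^ 2 * σ ^ 2) =
      Real.sqrt (|Real.cos t| ^ 2 + 4 * (1 - |Real.cos t| ^ 2) * σ ^ 2) := by
    intro t σ; congr 1; rw [sq_abs, Real.sin_sq]; ring
  simp only [edgeSheet, sRepAmp_eq_fold, h]

/-- **K4′/nodal-K3 geometry input, certified (Momentum level):** the band-edge sheet function of the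
`s`-representation under `RidgeClear η q`, two-sided around the fold with `P₀ = edgeSheetFold μ q`.
[cite: RaghuKivelsonScalapino2010, §II (5)–(6)] -/
theorem edgeSheet_fold_two_sided (μ : ℝ) (q : Momentum) {η : ℝ} (hη : 0 < η) (hR : RidgeClear η q) (s : ℝ) :
    edgeSheetFold μ q +
          16 * (|Real.cos (q 0 / 2)| + |Real.cos (q 1 / 2)|) ^ 2 *
            (1 / (|Real.cos (q 0 / 2)| * |Real.cos (q 1 / 2)|) - 1) * (s - 1 / 2) ^ 2 +
          64 * (1 - |Real.cos (q 0 / 2)| ^ 2) * (1 - |Real.cos (q 1 / 2)| ^ 2) * (s - 1 / 2) ^ 4 /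
            (|Real.cos (q 0 / 2)| * |Real.cos (q 1 / 2)|) -
          |Real.cos (q 0 / 2)| * |Real.cos (q 1 / 2)| *
            sRepFoldT (|Real.cos (q 0 / 2)|) (|Real.cos (q 1 / 2)|) (1 - |Real.cos (q 0 / 2)| ^ 2)
              (1 - |Real.cos (q 1 / 2)| ^ 2) (s - 1 / 2) ^ 2 ≤ edgeSheet μ q s ∧
      edgeSheet μ q s ≤
        edgeSheetFold μ q +
          16 * (|Real.cos (q 0 / 2)| + |Real.cos (q 1 / 2)|) ^ 2 *
            (1 / (|Real.cos (q 0 / 2)| * |Real.cos (q 1 / 2)|) - 1) * (s - 1 / 2) ^ 2 +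
          64 * (1 - |Real.cos (q 0 / 2)| ^ 2) * (1 - |Real.cos (q 1 / 2)| ^ 2) * (s - 1 / 2) ^ 4 /
            (|Real.cos (q 0 / 2)| * |Real.cos (q 1 / 2)|) := by
  rw [edgeSheet_eq_fold]
  unfold edgeSheetFold
  exact edge_sheet_fold_two_sided (hη.trans_le (hR 0)) (hη.trans_le (hR 1)) (Real.abs_cos_le_one _)
    (Real.abs_cos_le_one _) μ (s - 1 / 2)


/-! ### (f) The quadratic pinch at the fold: `X₀ − (3κ/2)σ² ≤ X(s) ≤ X₀ − (κ/2)σ²` near the fold -/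

/-- `T ≤ 9σ²/(c₀²c₁²)` for `σ² ≤ 1/18` (`0 < cᵢ ≤ 1`).
[cite: RaghuKivelsonScalapino2010, §II (5)–(6)] -/
theorem sRepFoldT_le {c₀ c₁ : ℝ} (hc₀ : 0 < c₀) (hc₁ : 0 < c₁) (hc₀1 : c₀ ≤ 1) (hc₁1 : c₁ ≤ 1)
    {σ : ℝ} (hσ : σ ^ 2 ≤ 1 / 18) :
    sRepFoldT c₀ c₁ (1 - c₀ ^ 2) (1 - c₁ ^ 2) σ ≤ 9 * σ ^ 2 / (c₀ ^ 2 * c₁ ^ 2) := by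
  unfold sRepFoldT
  apply div_le_div_of_nonneg_right _ (by positivity)
  have hS₀ : 0 ≤ 1 - c₀ ^ 2 := by nlinarith
  have hS₁ : 0 ≤ 1 - c₁ ^ 2 := by nlinarith
  have h1 : (1 - c₀ ^ 2) * c₁ ^ 2 + (1 - c₁ ^ 2) * c₀ ^ 2 ≤ 2 := by nlinarith
  have h2 : (1 - c₀ ^ 2) * (1 - c₁ ^ 2) ≤ 1 := by nlinarith [mul_nonneg hS₀ hS₁]
  have hσ0 : 0 ≤ σ ^ 2 := sq_nonneg σ
  have h4 : σ ^ 4 = σ ^ 2 * σ ^ 2 := by ring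
  have h3 : 16 * (1 - c₀ ^ 2) * (1 - c₁ ^ 2) * σ ^ 4 ≤ σ ^ 2 := by
    rw [h4]
    have := mul_le_mul_of_nonneg_left hσ hσ0
    nlinarith [mul_nonneg hS₀ hS₁, mul_nonneg (mul_nonneg hS₀ hS₁) (mul_nonneg hσ0 hσ0)]
  nlinarith [mul_le_mul_of_nonneg_left h1 (mul_nonneg (by norm_num : (0:ℝ) ≤ 4) hσ0)]

/-- **Quadratic pinch of the Kohn sheet function at the fold (abstract sheet coordinates).** For
`0 < cᵢ ≤ 1` and `σ² ≤ (c₀−c₁)²(c₀c₁)²/18`: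
`X₀ − (3κ/2)σ² ≤ 4(A₁−A₀)² − μ² ≤ X₀ − (κ/2)σ²`, `κ = 16(c₀−c₁)²(1 + 1/(c₀c₁))` — the closed-form
version of a curvature certificate `|ξ″| ≥ g` at a double zero of the sheet function (on the sheet `X₀ = 0`
this gives `κσ²/2 ≤ −X(s) ≤ 3κσ²/2`). [cite: RaghuKivelsonScalapino2010, §II (5)–(6)] -/
theorem kohn_sheet_fold_pinch {c₀ c₁ : ℝ} (hc₀ : 0 < c₀) (hc₁ : 0 < c₁) (hc₀1 : c₀ ≤ 1)
    (hc₁1 : c₁ ≤ 1) (μ : ℝ) {σ : ℝ} (hσ : σ ^ 2 ≤ (c₀ - c₁) ^ 2 * (c₀ * c₁) ^ 2 / 18) :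
    4 * (c₁ - c₀) ^ 2 - μ ^ 2 - 24 * (c₀ - c₁) ^ 2 * (1 + 1 / (c₀ * c₁)) * σ ^ 2 ≤
        4 * (Real.sqrt (c₁ ^ 2 + 4 * (1 - c₁ ^ 2) * σ ^ 2) -
            Real.sqrt (c₀ ^ 2 + 4 * (1 - c₀ ^ 2) * σ ^ 2)) ^ 2 - μ ^ 2 ∧
      4 * (Real.sqrt (c₁ ^ 2 + 4 * (1 - c₁ ^ 2) * σ ^ 2) -
            Real.sqrt (c₀ ^ 2 + 4 * (1 - c₀ ^ 2) * σ ^ 2)) ^ 2 - μ ^ 2 ≤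
        4 * (c₁ - c₀) ^ 2 - μ ^ 2 - 8 * (c₀ - c₁) ^ 2 * (1 + 1 / (c₀ * c₁)) * σ ^ 2 := by
  have hu : 0 < c₀ * c₁ := mul_pos hc₀ hc₁
  have hu1 : c₀ * c₁ ≤ 1 := by nlinarith
  have hS₀ : 0 ≤ 1 - c₀ ^ 2 := by nlinarith
  have hS₁ : 0 ≤ 1 - c₁ ^ 2 := by nlinarith
  have hd1 : (c₀ - c₁) ^ 2 ≤ 1 := by nlinarith
  have hσ0 : 0 ≤ σ ^ 2 := sq_nonneg σ
  have hd0 : 0 ≤ (c₀ - c₁) ^ 2 := sq_nonneg _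
  have husq1 : (c₀ * c₁) ^ 2 ≤ 1 := by nlinarith
  -- `σ² ≤ (c₀−c₁)²/18 ≤ 1/18`
  have hσd : σ ^ 2 ≤ (c₀ - c₁) ^ 2 / 18 := by
    have : (c₀ - c₁) ^ 2 * (c₀ * c₁) ^ 2 ≤ (c₀ - c₁) ^ 2 * 1 :=
      mul_le_mul_of_nonneg_left husq1 hd0
    have h' : (c₀ - c₁) ^ 2 * (c₀ * c₁) ^ 2 / 18 ≤ (c₀ - c₁) ^ 2 / 18 :=
      div_le_div_of_nonneg_right (by linarith) (by norm_num)
    exact hσ.trans h'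
  have hσ18 : σ ^ 2 ≤ 1 / 18 := hσd.trans (by linarith)
  -- the `T²` term: `c₀c₁·T² ≤ 81σ⁴/(c₀c₁)³ ≤ 8(c₀−c₁)²σ²/(c₀c₁) ≤ (κ/2)σ²`
  have hT0 : 0 ≤ sRepFoldT c₀ c₁ (1 - c₀ ^ 2) (1 - c₁ ^ 2) σ := sRepFoldT_nonneg hS₀ hS₁ σ
  have hT : sRepFoldT c₀ c₁ (1 - c₀ ^ 2) (1 - c₁ ^ 2) σ ≤ 9 * σ ^ 2 / (c₀ ^ 2 * c₁ ^ 2) :=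
    sRepFoldT_le hc₀ hc₁ hc₀1 hc₁1 hσ18
  have hT2 : sRepFoldT c₀ c₁ (1 - c₀ ^ 2) (1 - c₁ ^ 2) σ ^ 2 ≤ (9 * σ ^ 2 / (c₀ ^ 2 * c₁ ^ 2)) ^ 2 :=
    pow_le_pow_left₀ hT0 hT 2
  have hT2' : c₀ * c₁ * sRepFoldT c₀ c₁ (1 - c₀ ^ 2) (1 - c₁ ^ 2) σ ^ 2 ≤ 81 * σ ^ 4 / (c₀ * c₁) ^ 3 := by
    have e : c₀ * c₁ * (9 * σ ^ 2 / (c₀ ^ 2 * c₁ ^ 2)) ^ 2 = 81 * σ ^ 4 / (c₀ * c₁) ^ 3 := by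
      field_simp
      ring
    rw [← e]
    exact mul_le_mul_of_nonneg_left hT2 hu.le
  have h81 : 81 * σ ^ 4 / (c₀ * c₁) ^ 3 ≤ 8 * (c₀ - c₁) ^ 2 * σ ^ 2 / (c₀ * c₁) := by
    rw [div_le_div_iff₀ (by positivity) hu]
    -- `81σ⁴·u ≤ 8(c₀−c₁)²σ²·u³`, from `18σ² ≤ (c₀−c₁)²u²`
    have h18 : 18 * σ ^ 2 ≤ (c₀ - c₁) ^ 2 * (c₀ * c₁) ^ 2 := by
      have := hσ; rw [le_div_iff₀ (by norm_num : (0:ℝ) < 18)] at this; linarith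
    -- multiply by `σ²·u ≥ 0`: `18σ⁴u ≤ (c₀−c₁)²u³σ²`
    have h18' : σ ^ 2 * (c₀ * c₁) * (18 * σ ^ 2) ≤ σ ^ 2 * (c₀ * c₁) * ((c₀ - c₁) ^ 2 * (c₀ * c₁) ^ 2) :=
      mul_le_mul_of_nonneg_left h18 (mul_nonneg hσ0 hu.le)
    have hnn : 0 ≤ σ ^ 2 * (c₀ * c₁) * ((c₀ - c₁) ^ 2 * (c₀ * c₁) ^ 2) := by positivity
    have e1 : 81 * σ ^ 4 * (c₀ * c₁) = (81 / 18) * (σ ^ 2 * (c₀ * c₁) * (18 * σ ^ 2)) := by ring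
    have e2 : 8 * (c₀ - c₁) ^ 2 * σ ^ 2 * (c₀ * c₁) ^ 3 =
        8 * (σ ^ 2 * (c₀ * c₁) * ((c₀ - c₁) ^ 2 * (c₀ * c₁) ^ 2)) := by ring
    rw [e1, e2]
    linarith [h18', hnn]
  have hinv : 8 * (c₀ - c₁) ^ 2 * σ ^ 2 / (c₀ * c₁) ≤
      8 * (c₀ - c₁) ^ 2 * (1 + 1 / (c₀ * c₁)) * σ ^ 2 := by
    have e : 8 * (c₀ - c₁) ^ 2 * (1 + 1 / (c₀ * c₁)) * σ ^ 2 =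
        8 * (c₀ - c₁) ^ 2 * σ ^ 2 + 8 * (c₀ - c₁) ^ 2 * σ ^ 2 / (c₀ * c₁) := by ring
    rw [e]
    have : 0 ≤ 8 * (c₀ - c₁) ^ 2 * σ ^ 2 := by positivity
    linarith
  -- the `σ⁴` term: `64S₀S₁σ⁴/(c₀c₁) ≤ 8(c₀−c₁)²σ²/(c₀c₁) ≤ (κ/2)σ²`
  have hP1 : (1 - c₀ ^ 2) * (1 - c₁ ^ 2) ≤ 1 := by nlinarith [mul_nonneg hS₀ hS₁]
  have h64 : 64 * (1 - c₀ ^ 2) * (1 - c₁ ^ 2) * σ ^ 4 / (c₀ * c₁) ≤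
      8 * (c₀ - c₁) ^ 2 * σ ^ 2 / (c₀ * c₁) := by
    apply div_le_div_of_nonneg_right _ hu.le
    have e4 : σ ^ 4 = σ ^ 2 * σ ^ 2 := by ring
    rw [e4]
    have h8 : σ ^ 2 ≤ (c₀ - c₁) ^ 2 / 8 := by linarith
    have s1 : (1 - c₀ ^ 2) * (1 - c₁ ^ 2) * (σ ^ 2 * σ ^ 2) ≤ 1 * (σ ^ 2 * σ ^ 2) :=
      mul_le_mul_of_nonneg_right hP1 (mul_nonneg hσ0 hσ0)
    have s2 : σ ^ 2 * σ ^ 2 ≤ σ ^ 2 * ((c₀ - c₁) ^ 2 / 8) := mul_le_mul_of_nonneg_left h8 hσ0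
    have e : 64 * (1 - c₀ ^ 2) * (1 - c₁ ^ 2) * (σ ^ 2 * σ ^ 2) =
        64 * ((1 - c₀ ^ 2) * (1 - c₁ ^ 2) * (σ ^ 2 * σ ^ 2)) := by ring
    rw [e]
    linarith [s1, s2]
  have h64nn : 0 ≤ 64 * (1 - c₀ ^ 2) * (1 - c₁ ^ 2) * σ ^ 4 / (c₀ * c₁) := by positivity
  obtain ⟨hlo, hhi⟩ := kohn_sheet_fold_two_sided hc₀ hc₁ hc₀1 hc₁1 μ σ
  constructor
  · linarith [hlo, h64, hinv]
  · linarith [hhi, hT2', h81, hinv, h64nn]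

/-- **Quadratic pinch of the Kohn sheet function at the fold (Momentum level).** Under
`RidgeClear η q` (`η > 0`), with `cᵢ = |cos(qᵢ/2)|` and `(s−½)² ≤ (c₀−c₁)²(c₀c₁)²/18`:
`X₀ − (3κ/2)(s−½)² ≤ X(s) ≤ X₀ − (κ/2)(s−½)²`, `κ = 16(c₀−c₁)²(1 + 1/(c₀c₁))`.
[cite: RaghuKivelsonScalapino2010, §II (5)–(6)] -/
theorem kohnSheet_fold_pinch (μ : ℝ) (q : Momentum) {η : ℝ} (hη : 0 < η) (hR : RidgeClear η q)
    {s : ℝ} (hs : (s - 1 / 2) ^ 2 ≤ (|Real.cos (q 0 / 2)| - |Real.cos (q 1 / 2)|) ^ 2 *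
      (|Real.cos (q 0 / 2)| * |Real.cos (q 1 / 2)|) ^ 2 / 18) :
    kohnSheetFold μ q -
          24 * (|Real.cos (q 0 / 2)| - |Real.cos (q 1 / 2)|) ^ 2 *
            (1 + 1 / (|Real.cos (q 0 / 2)| * |Real.cos (q 1 / 2)|)) * (s - 1 / 2) ^ 2 ≤ kohnSheet μ q s ∧
      kohnSheet μ q s ≤
        kohnSheetFold μ q -
          8 * (|Real.cos (q 0 / 2)| - |Real.cos (q 1 / 2)|) ^ 2 *
            (1 + 1 / (|Real.cos (q 0 / 2)| * |Real.cos (q 1 / 2)|)) * (s - 1 / 2) ^ 2 := by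
  rw [kohnSheet_eq_fold]
  unfold kohnSheetFold
  exact kohn_sheet_fold_pinch (hη.trans_le (hR 0)) (hη.trans_le (hR 1)) (Real.abs_cos_le_one _)
    (Real.abs_cos_le_one _) μ hs

end Summit.HubbardSuperconductivity.HubbardSuperconductivity.Theorems

end
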